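import Literature.Probability.LatticeModels.MedialInterface
import Mathlib.Probability.ProductMeasure
import Mathlib.Probability.Distributions.SetBernoulli
import Mathlib.Probability.Distributions.Bernoulli

/-! # Flip invariance of critical bond percolation on `ℤ²` (helper of stub `stub_halfCR`, line `Sketch`,
# crux `CardySusyWard.WeakHolomorphy`, stmt-CriticalPhenomena-11292)

Registered stub `stub_flipInvariance`: for every lattice edge `e` of `ℤ²` and every integrand `F`,
`∫ F (ω ∆ {e}) dP_{1/2} = ∫ F dP_{1/2}` — the edge flip `ω ↦ ω ∆ {e}` is a measurable involution
preserving Bernoulli-`1/2` bond percolation `bondPercolation (zdGraph 2) half = setBer(E(ℤ²), 1/2)`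
(the one-edge law `½δ_⊤ + ½δ_⊥` is invariant under negation; `Measure.infinitePi_map_pi`).  This is the
measure-theoretic half of the coin involution behind Smirnov's / Duminil-Copin's vertex relation
(Duminil-Copin 2012, arXiv:1208.3787, proof of Prop. 4).  Written by the wave-2 stub worker of the lead
`prover-line-stmt-CriticalPhenomena-11292-0`; split off the assembly file for the 400-line rule.
-/

noncomputable section

namespace Summit.CriticalPhenomena.CardyFormulaZ2.Theorems.WeakHolomorphy.SplitBypass

open scoped symmDiff
open MeasureTheory
open _root_.Literature.Probability.LatticeModels
open _root_.Literature.Probability.Percolation (BondConfig bondPercolation half)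

/-! ## The edge flip preserves `P_{1/2}` -/

/-- Flipping one coordinate is measurable on `Set`-valued configurations. [folklore] -/
theorem measurable_symmDiff_singleton (e : Sym2 (Site 2)) :
    Measurable fun ω : BondConfig (Site 2) => ω ∆ {e} := by
  refine measurable_set_iff.2 fun a => ?_
  by_cases hae : a = e
  · subst hae
    have : (fun ω : BondConfig (Site 2) => a ∈ ω ∆ ({a} : Set (Sym2 (Site 2)))) = fun ω => a ∉ ω := by
      funext ω; simp [Set.mem_symmDiff]
    rw [this]; exact measurable_set_notMem a
  · have : (fun ω : BondConfig (Site 2) => a ∈ ω ∆ ({e} : Set (Sym2 (Site 2)))) = fun ω => a ∈ ω := by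
      funext ω; simp [Set.mem_symmDiff, hae]
    rw [this]; exact measurable_set_mem a

open ProbabilityTheory unitInterval in
/-- **The flip of a lattice edge preserves critical bond percolation**: the image of `P_{1/2}` under
`ω ↦ ω ∆ {e}` is `P_{1/2}` (the one-edge law `½ δ_⊤ + ½ δ_⊥` is invariant under negation).
[folklore] -/
theorem bondPercolation_half_map_symmDiff {e : Sym2 (Site 2)} (he : e ∈ (zdGraph 2).edgeSet) :
    (bondPercolation (zdGraph 2) half).map (fun ω => ω ∆ {e}) = bondPercolation (zdGraph 2) half := by
  classical
  set ν : Sym2 (Site 2) → Measure Prop := fun i =>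
    toNNReal half • Measure.dirac (i ∈ (zdGraph 2).edgeSet) + toNNReal (σ half) • Measure.dirac False with hν
  set f : (i : Sym2 (Site 2)) → Prop → Prop := fun i P => if i = e then ¬ P else P with hf
  have hfm : ∀ i, Measurable (f i) := fun i => Measurable.of_discrete
  have hmf : Measurable (fun (x : Sym2 (Site 2) → Prop) i => f i (x i)) :=
    measurable_pi_lambda _ fun i => (hfm i).comp (measurable_pi_apply i)
  have hs : σ half = half := Subtype.ext (by simp [half]; norm_num)
  have hν' : (fun i => (ν i).map (f i)) = ν := by
    funext i
    by_cases hi : i = e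
    · subst hi
      have hiE : (i ∈ (zdGraph 2).edgeSet) = True := propext ⟨fun _ => trivial, fun _ => he⟩
      have hf' : f i = Not := by funext P; simp [hf]
      simp only [hν, hiE, hf']
      rw [Measure.map_add _ _ Measurable.of_discrete, Measure.map_smul, Measure.map_smul,
        Measure.map_dirac' Measurable.of_discrete, Measure.map_dirac' Measurable.of_discrete, hs, add_comm]
      congr 3
      · exact propext ⟨fun _ => trivial, fun _ => not_false⟩
      · exact propext ⟨fun h => (h trivial).elim, fun h => h.elim⟩
    · have hf' : f i = id := by funext P; simp [hf, hi]
      rw [hf', Measure.map_id]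
  haveI : ∀ i, IsProbabilityMeasure (ν i) := fun i => by
    rw [show ν i = bernoulliMeasure (i ∈ (zdGraph 2).edgeSet) False half from rfl]; infer_instance
  have hmap : (Measure.infinitePi ν).map (fun x i => f i (x i)) = Measure.infinitePi ν := by
    rw [Measure.infinitePi_map_pi ν hfm, hν']
  have hcomm : (fun ω : BondConfig (Site 2) => ω ∆ {e}) ∘ (fun q : Sym2 (Site 2) → Prop => {i | q i}) =
      (fun q : Sym2 (Site 2) → Prop => {i | q i}) ∘ (fun x i => f i (x i)) := by
    funext q
    ext a
    simp only [Function.comp_apply, Set.mem_symmDiff, Set.mem_setOf_eq, Set.mem_singleton_iff, hf]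
    by_cases ha : a = e
    · subst ha; simp
    · simp [ha]
  have hP : bondPercolation (zdGraph 2) half = (Measure.infinitePi ν).map (fun q => {i | q i}) := by
    rw [bondPercolation, setBernoulli_eq_map]
  rw [hP, Measure.map_map (measurable_symmDiff_singleton e) measurable_setOf, hcomm,
    ← Measure.map_map measurable_setOf hmf, hmap]

/-- **Flip invariance of expectations**: `∫ F (ω ∆ {e}) dP_{1/2} = ∫ F dP_{1/2}` for every lattice edge
`e` and every `F` (no measurability needed: the flip is a measurable involution). [folklore] -/
theorem integral_comp_symmDiff {e : Sym2 (Site 2)} (he : e ∈ (zdGraph 2).edgeSet) (F : BondConfig (Site 2) → ℂ) :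
    ∫ ω, F (ω ∆ {e}) ∂(bondPercolation (zdGraph 2) half) = ∫ ω, F ω ∂(bondPercolation (zdGraph 2) half) := by
  set T : BondConfig (Site 2) ≃ᵐ BondConfig (Site 2) :=
    { toFun := fun ω => ω ∆ {e}
      invFun := fun ω => ω ∆ {e}
      left_inv := fun ω => symmDiff_symmDiff_cancel_right _ _
      right_inv := fun ω => symmDiff_symmDiff_cancel_right _ _
      measurable_toFun := measurable_symmDiff_singleton e
      measurable_invFun := measurable_symmDiff_singleton e } with hT
  have h := T.measurableEmbedding.integral_map (μ := bondPercolation (zdGraph 2) half) F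
  have hTc : (T : BondConfig (Site 2) → BondConfig (Site 2)) = fun ω => ω ∆ {e} := rfl
  rw [hTc, bondPercolation_half_map_symmDiff he] at h
  exact h.symm


/-- **Registered stub `stub_flipInvariance`**: flip invariance of `P_{1/2}`-expectations. [folklore] -/
theorem stub_flipInvariance : ∀ (e : Sym2 (Site 2)), e ∈ (zdGraph 2).edgeSet →
    ∀ (F : BondConfig (Site 2) → ℂ),
      ∫ ω, F (ω ∆ {e}) ∂(bondPercolation (zdGraph 2) half) = ∫ ω, F ω ∂(bondPercolation (zdGraph 2) half) :=
  fun _ he F => integral_comp_symmDiff he F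

end Summit.CriticalPhenomena.CardyFormulaZ2.Theorems.WeakHolomorphy.SplitBypass

end
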